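import Literature.Analysis.FluidPDE.Tao2016AveragedNS.SplitCascadeBlowupDynamics
import Literature.Analysis.FluidPDE.Tao2016AveragedNS.SplitCascadeTable
import HarnessLib

/-!
# Tao's cascade ODE with the squared modes doubled, III: the conclusions of Lemma 4.1 for the split
# table and the two-wavelet datum give the split system — "Theorem 4.2♯ ⇐ Theorem 6.2♯"

T. Tao, *Finite time blowup for an averaged three-dimensional Navier–Stokes equation*, J. Amer.
Math. Soc. **29** (2016) 601–674 = arXiv:1402.0290v3, §4 (Lemma 4.1 (4.5)–(4.11), Theorem 4.2) and
§6.1 ("To prove Theorem 4.2, it thus suffices to show Theorem 6.2", p. 31) [`Tao2016AveragedNS`].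
Split companion of the tree's `TaoCascade.CascadeODESolution.toTaoODESystem` /
`TaoCascade.odeBlowup_of_noGlobalODESolution` (`TaoCascadeODEProofs.lean`).

HONEST FRAMING (cell harvest/h2-tao-ladder, rung 1 of a ladder of MODEL equations; RUNG1-HANDOFF
h4 / R1-b): the cell's split cascade has a SQUARE-FREE table (`splitCoeff_squareFree`), so Tao's
single-wavelet datum (4.4)/(4.7) freezes it (every single-mode state of a square-free circuit is an
equilibrium, `splitDelayCircuit_single`); the split witness loads BOTH copies of the input mode of
shell `n₀`, `u₀ = (ψ_{a′,n₀} + ψ_{a″,n₀})/√2`. This file therefore (i) generalises the FORMAT of the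
conclusions of Lemma 4.1 to a datum supported on the shell `n₀` with arbitrary mode amplitudes
`X₀ : Fin m → ℝ` (`CascadeODESolutionFrom`; Tao's format is the case `X₀ = 1_{i₀}`,
`CascadeODESolution.toFrom`), and (ii) PROVES that those conclusions, for the split table and the
two-wavelet amplitudes `splitDatum = (1/√2, 1/√2, 0, …, 0)`, yield — in the swap-symmetric /
antisymmetric coordinates `symAmp`, `asymAmp` and with the combined energies `Eₙ = ∑ᵢ E_{i,n}` — a
solution of the split system (6.0♯)–(6.8♯) (`SplitODESystem`) with implied constants `√2·K₁, K₂`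
(`CascadeODESolutionFrom.toSplitODESystem`). Consequently the ODE half of the cell's rung-1 dynamics
claim reduces to the single statement "no global solution of the split system"
(`splitOdeBlowup_of_noGlobalSplit`: Theorem 4.2♯ ⇐ Theorem 6.2♯, both written out, neither
asserted). The split analogue of Lemma 4.1 itself (mild solution with the two-wavelet datum ⇒
`CascadeODESolutionFrom … splitDatum`) is NOT here; nothing here concerns Navier–Stokes.
-/

noncomputable section

open Set MeasureTheory intervalIntegral Finset

namespace Literature.Analysis.FluidPDE

namespace TaoCascade

/-! ### The conclusions of Lemma 4.1 for a datum supported on one shell -/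

/-- **The conclusions (4.5)–(4.11) of Tao's Lemma 4.1 for a datum supported on the shell `n₀` with
mode amplitudes `X₀`** (`u₀ = ∑ᵢ X₀ᵢ ψ_{i,n₀}`): identical to `CascadeODESolution` except that (4.7)
reads `X_{i,n}(0) = X₀ᵢ · 1_{n = n₀}` (and (4.6) `E_{i,n}(0) = ½X_{i,n}(0)²` accordingly). Tao's datum
(4.4) is `X₀ = 1_{i₀}` (`CascadeODESolution.toFrom`); the cell's split witness needs
`X₀ = (1/√2)(1_{a′} + 1_{a″})`. [cite: Tao2016AveragedNS, §4 Lemma 4.1 (4.5)–(4.11)] -/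
structure CascadeODESolutionFrom (ε₀ : ℝ) {m : ℕ}
    (α : Fin m → Fin m → Fin m → ℤ × ℤ × ℤ → ℝ) (K₁ K₂ : ℝ) (n₀ : ℤ) (X₀ : Fin m → ℝ)
    (X E : Fin m → ℤ → ℝ → ℝ) : Prop where
  /-- `X_{i,n}` is continuously differentiable on `[0,+∞)`. -/
  contDiffOn_X : ∀ i n, ContDiffOn ℝ 1 (X i n) (Ici 0)
  /-- `E_{i,n}` is continuously differentiable on `[0,+∞)`. -/
  contDiffOn_E : ∀ i n, ContDiffOn ℝ 1 (E i n) (Ici 0)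
  /-- `E_{i,n}` takes values in `[0,+∞)`. -/
  nonneg_E : ∀ i n t, 0 ≤ t → 0 ≤ E i n t
  /-- (4.5), first half: a priori regularity of the coefficients. -/
  apriori_X : ∀ T : ℝ, 0 < T → ∃ M : ℝ, ∀ t ∈ Icc 0 T, ∀ (i : Fin m) (n : ℤ),
    (1 + (1 + ε₀) ^ ((10 : ℝ) * n)) * |X i n t| ≤ M
  /-- (4.5), second half: a priori regularity of the local energies. -/
  apriori_E : ∀ T : ℝ, 0 < T → ∃ M : ℝ, ∀ t ∈ Icc 0 T, ∀ (i : Fin m) (n : ℤ),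
    (1 + (1 + ε₀) ^ ((10 : ℝ) * n)) * Real.sqrt (E i n t) ≤ M
  /-- (4.6): `E_{i,n}(0) = ½ X_{i,n}(0)²`. -/
  init_E : ∀ i n, E i n 0 = (1 / 2) * X i n 0 ^ 2
  /-- (4.7) for the datum `u₀ = ∑ᵢ X₀ᵢ ψ_{i,n₀}`: `X_{i,n}(0) = X₀ᵢ 1_{n = n₀}`. -/
  init_X : ∀ i n, X i n 0 = if n = n₀ then X₀ i else 0
  /-- (4.8): the equation of motion, with implied constant `K₁`. -/
  motion : ∀ i n t, 0 ≤ t →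
    |derivWithin (X i n) (Ici 0) t - quadTerm ε₀ α X i n t| ≤
      K₁ * (1 + ε₀) ^ ((2 : ℝ) * n) * Real.sqrt (E i n t)
  /-- (4.9): the local energy inequality. -/
  energy : ∀ i n t, 0 ≤ t → derivWithin (E i n) (Ici 0) t ≤ quadTerm ε₀ α X i n t * X i n t
  /-- (4.10), lower bound: `½ X_{i,n}² ≤ E_{i,n}`. -/
  defect_lower : ∀ i n t, 0 ≤ t → (1 / 2) * X i n t ^ 2 ≤ E i n t
  /-- (4.10), upper bound, with implied constant `K₂`. -/
  defect_upper : ∀ i n t, 0 ≤ t →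
    E i n t ≤ (1 / 2) * X i n t ^ 2 + K₂ * (1 + ε₀) ^ ((2 : ℝ) * n) * ∫ s in (0 : ℝ)..t, E i n s
  /-- (4.11): no very low frequencies, coefficients. -/
  noLow_X : ∀ i n t, n < n₀ → 0 ≤ t → X i n t = 0
  /-- (4.11): no very low frequencies, energies. -/
  noLow_E : ∀ i n t, n < n₀ → 0 ≤ t → E i n t = 0

/-- Tao's single-wavelet format is the case `X₀ = 1_{i₀}` of the shell-supported format.
[cite: Tao2016AveragedNS, §4 (4.4), (4.7)] -/
theorem CascadeODESolution.toFrom {ε₀ : ℝ} {m : ℕ} {i₀ : Fin m}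
    {α : Fin m → Fin m → Fin m → ℤ × ℤ × ℤ → ℝ} {K₁ K₂ : ℝ} {n₀ : ℤ} {X E : Fin m → ℤ → ℝ → ℝ}
    (h : CascadeODESolution ε₀ i₀ α K₁ K₂ n₀ X E) :
    CascadeODESolutionFrom ε₀ α K₁ K₂ n₀ (fun i => if i = i₀ then 1 else 0) X E where
  contDiffOn_X := h.contDiffOn_X
  contDiffOn_E := h.contDiffOn_E
  nonneg_E := h.nonneg_E
  apriori_X := h.apriori_X
  apriori_E := h.apriori_E
  init_E := h.init_E
  init_X i n := by
    rw [h.init_X]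
    by_cases hi : i = i₀ <;> by_cases hn : n = n₀ <;> simp [hi, hn]
  motion := h.motion
  energy := h.energy
  defect_lower := h.defect_lower
  defect_upper := h.defect_upper
  noLow_X := h.noLow_X
  noLow_E := h.noLow_E

/-- `√(∑ E) ≤ ∑ √E` for non-negative reals. [folklore] -/
private theorem sqrt_finset_sum_le {ι : Type*} (s : Finset ι) (E : ι → ℝ) (hE : ∀ i ∈ s, 0 ≤ E i) :
    Real.sqrt (∑ i ∈ s, E i) ≤ ∑ i ∈ s, Real.sqrt (E i) := by
  classical
  induction s using Finset.induction_on with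
  | empty => simp
  | insert a s ha ih =>
    rw [Finset.sum_insert ha, Finset.sum_insert ha]
    have hEa : 0 ≤ E a := hE a (Finset.mem_insert_self a s)
    have hEs : 0 ≤ ∑ i ∈ s, E i := Finset.sum_nonneg fun i hi => hE i (Finset.mem_insert_of_mem hi)
    have hrest := ih fun i hi => hE i (Finset.mem_insert_of_mem hi)
    have hadd : Real.sqrt (E a + ∑ i ∈ s, E i) ≤ Real.sqrt (E a) + Real.sqrt (∑ i ∈ s, E i) := by
      rw [Real.sqrt_le_left (by positivity)]
      nlinarith [Real.sq_sqrt hEa, Real.sq_sqrt hEs, Real.sqrt_nonneg (E a),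
        Real.sqrt_nonneg (∑ i ∈ s, E i)]
    linarith

end TaoCascade

namespace Tao2016AveragedNS

open TaoCascade

/-! ### The split datum and the derivative of the change of coordinates -/

/-- **The split datum**: the mode amplitudes `(1/√2, 1/√2, 0, 0, 0, 0, 0)` on the shell `n₀` — both
copies `a′, a″` of the input mode loaded equally, `u₀ = (ψ_{a′,n₀} + ψ_{a″,n₀})/√2`, of unit energy,
symmetric amplitude `S_a(0) = 1` and no asymmetry (the diagonal image `diagEmbed delayInit` of
Tao's (5.6)). [cite: Tao2016AveragedNS, §4 (4.4)] -/
def splitDatum : Fin 7 → ℝ := ![Real.sqrt 2 / 2, Real.sqrt 2 / 2, 0, 0, 0, 0, 0]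

/-- `(√2)² = 2`. [folklore] -/
private theorem sqrt_two_mul_self : Real.sqrt 2 * Real.sqrt 2 = 2 :=
  Real.mul_self_sqrt (by norm_num)

/-- `1 ≤ √2`. [folklore] -/
private theorem one_le_sqrt_two : (1 : ℝ) ≤ Real.sqrt 2 := by
  rw [show (1 : ℝ) = Real.sqrt 1 from Real.sqrt_one.symm]
  exact Real.sqrt_le_sqrt (by norm_num)

section Deriv

variable {f g : ℝ → ℝ} {t : ℝ}

/-- One-sided derivative of `(√2/2)(f + g)` on `[0,+∞)`. [folklore] -/
private theorem derivWithin_half_sqrt_two_add (hf : ContDiffOn ℝ 1 f (Ici 0))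
    (hg : ContDiffOn ℝ 1 g (Ici 0)) (ht : 0 ≤ t) :
    derivWithin (fun s => Real.sqrt 2 / 2 * (f s + g s)) (Ici 0) t =
      Real.sqrt 2 / 2 * (derivWithin f (Ici 0) t + derivWithin g (Ici 0) t) := by
  have hf' := ((hf.differentiableOn one_ne_zero) t ht).hasDerivWithinAt
  have hg' := ((hg.differentiableOn one_ne_zero) t ht).hasDerivWithinAt
  exact ((hf'.add hg').const_mul (Real.sqrt 2 / 2)).derivWithin (uniqueDiffOn_Ici 0 t ht)

/-- One-sided derivative of `(√2/2)(f - g)` on `[0,+∞)`. [folklore] -/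
private theorem derivWithin_half_sqrt_two_sub (hf : ContDiffOn ℝ 1 f (Ici 0))
    (hg : ContDiffOn ℝ 1 g (Ici 0)) (ht : 0 ≤ t) :
    derivWithin (fun s => Real.sqrt 2 / 2 * (f s - g s)) (Ici 0) t =
      Real.sqrt 2 / 2 * (derivWithin f (Ici 0) t - derivWithin g (Ici 0) t) := by
  have hf' := ((hf.differentiableOn one_ne_zero) t ht).hasDerivWithinAt
  have hg' := ((hg.differentiableOn one_ne_zero) t ht).hasDerivWithinAt
  exact ((hf'.sub hg').const_mul (Real.sqrt 2 / 2)).derivWithin (uniqueDiffOn_Ici 0 t ht)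

/-- `|(√2/2)(e₀ ± e₁)| ≤ (√2/2)(B₀ + B₁)` bookkeeping: if `|e₀| ≤ c√E₀`, `|e₁| ≤ c√E₁` with
`c ≥ 0` and `E₀, E₁ ≤ E`, `0 ≤ E₀, E₁`, then `(√2/2)(|e₀| + |e₁|) ≤ √2·c·√E`. [folklore] -/
private theorem half_sqrt_two_pair_le {e₀ e₁ c E₀ E₁ E : ℝ} (hc : 0 ≤ c) (h₀ : |e₀| ≤ c * Real.sqrt E₀)
    (h₁ : |e₁| ≤ c * Real.sqrt E₁) (hE₀ : E₀ ≤ E) (hE₁ : E₁ ≤ E) :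
    Real.sqrt 2 / 2 * (|e₀| + |e₁|) ≤ Real.sqrt 2 * c * Real.sqrt E := by
  have hs0 : Real.sqrt E₀ ≤ Real.sqrt E := Real.sqrt_le_sqrt hE₀
  have hs1 : Real.sqrt E₁ ≤ Real.sqrt E := Real.sqrt_le_sqrt hE₁
  have h2 : 0 ≤ Real.sqrt 2 := Real.sqrt_nonneg 2
  nlinarith [mul_le_mul_of_nonneg_left hs0 hc, mul_le_mul_of_nonneg_left hs1 hc]

end Deriv

/-! ### The conclusions of Lemma 4.1 for the split table give the split system -/

section Bridge

variable {ε₀ K ε K₁ K₂ : ℝ} {n₀ : ℤ} {X E : Fin 7 → ℤ → ℝ → ℝ}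

/-- **The conclusions of Lemma 4.1 for the split table and the two-wavelet datum give the split
system (6.0♯)–(6.8♯)** — the split analogue of Tao's passage from Lemma 4.1 (i)–(v) to
(6.1)–(6.10) (p. 31): with `S = symAmp X`, `Z = asymAmp X`, `Eₙ = ∑ᵢ E_{i,n}` and implied
constants `√2·K₁` (the rotation `(x′,x″) ↦ ((x′+x″)/√2, (x′-x″)/√2)` costs a factor `√2` in the
error class) and `K₂`. The rows are `quadTerm_splitCoeff_sym_*` / `_asym_*`, the flux is
`sum_quadTerm_mul_splitCoeff`, the datum gives `S_{a,n₀}(0) = 1`, `Z(0) = 0`, `E_{n₀}(0) = ½`.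
[cite: Tao2016AveragedNS, §6.1] -/
theorem _root_.Literature.Analysis.FluidPDE.TaoCascade.CascadeODESolutionFrom.toSplitODESystem
    (hε₀ : 0 < ε₀) (hK₁ : 0 ≤ K₁)
    (h : CascadeODESolutionFrom ε₀ (splitCoeff ε₀ K ε) K₁ K₂ n₀ splitDatum X E) :
    SplitODESystem ε₀ K ε (Real.sqrt 2 * K₁) K₂ n₀ (symAmp X) (asymAmp X)
      (fun n t => ∑ i, E i n t) := by
  have hε₁ : -1 < ε₀ := by linarith
  have hpos : 0 < 1 + ε₀ := by linarith
  -- bookkeeping: each local energy is below the combined one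
  have hle : ∀ (i : Fin 7) (n : ℤ) (t : ℝ), 0 ≤ t → E i n t ≤ ∑ j, E j n t := fun i n t ht =>
    Finset.single_le_sum (fun j _ => h.nonneg_E j n t ht) (Finset.mem_univ i)
  have hsum0 : ∀ (n : ℤ) (t : ℝ), 0 ≤ t → 0 ≤ ∑ j, E j n t := fun n t ht =>
    Finset.sum_nonneg fun j _ => h.nonneg_E j n t ht
  -- the error of one original row, and of a single row against the combined energy
  have hrow : ∀ (i : Fin 7) (n : ℤ) (t : ℝ), 0 ≤ t →
      |derivWithin (X i n) (Ici 0) t - quadTerm ε₀ (splitCoeff ε₀ K ε) X i n t| ≤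
        K₁ * (1 + ε₀) ^ ((2 : ℝ) * n) * Real.sqrt (E i n t) := h.motion
  have hw : ∀ n : ℤ, 0 ≤ K₁ * (1 + ε₀) ^ ((2 : ℝ) * n) := fun n => by positivity
  -- a pair of rows combined with weights √2/2
  have hpair : ∀ (i j : Fin 7) (n : ℤ) (t : ℝ), 0 ≤ t → ∀ (σ : ℝ), (σ = 1 ∨ σ = -1) →
      |Real.sqrt 2 / 2 * (derivWithin (X i n) (Ici 0) t + σ * derivWithin (X j n) (Ici 0) t) -
          Real.sqrt 2 / 2 * (quadTerm ε₀ (splitCoeff ε₀ K ε) X i n t +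
            σ * quadTerm ε₀ (splitCoeff ε₀ K ε) X j n t)| ≤
        Real.sqrt 2 * K₁ * (1 + ε₀) ^ ((2 : ℝ) * n) * Real.sqrt (∑ k, E k n t) := by
    intro i j n t ht σ hσ
    have hi := hrow i n t ht
    have hj := hrow j n t ht
    have hσ1 : |σ| = 1 := by rcases hσ with rfl | rfl <;> simp
    have hj' : |σ * (derivWithin (X j n) (Ici 0) t - quadTerm ε₀ (splitCoeff ε₀ K ε) X j n t)| ≤
        K₁ * (1 + ε₀) ^ ((2 : ℝ) * n) * Real.sqrt (E j n t) := by
      rw [abs_mul, hσ1, one_mul]; exact hj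
    have key := half_sqrt_two_pair_le (hw n) hi hj' (hle i n t ht) (hle j n t ht)
    calc _ = |Real.sqrt 2 / 2 * ((derivWithin (X i n) (Ici 0) t -
              quadTerm ε₀ (splitCoeff ε₀ K ε) X i n t) +
            σ * (derivWithin (X j n) (Ici 0) t - quadTerm ε₀ (splitCoeff ε₀ K ε) X j n t))| := by
          ring_nf
      _ ≤ Real.sqrt 2 / 2 * (|derivWithin (X i n) (Ici 0) t -
              quadTerm ε₀ (splitCoeff ε₀ K ε) X i n t| +
            |σ * (derivWithin (X j n) (Ici 0) t - quadTerm ε₀ (splitCoeff ε₀ K ε) X j n t)|) := by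
          rw [abs_mul, abs_of_nonneg (by positivity : (0 : ℝ) ≤ Real.sqrt 2 / 2)]
          exact mul_le_mul_of_nonneg_left (abs_add_le _ _) (by positivity)
      _ ≤ _ := by rw [mul_assoc (Real.sqrt 2) K₁]; exact key.trans (le_of_eq (by ring))
  refine
    { contDiffOn_S := ?_
      contDiffOn_Z := ?_
      contDiffOn_E := fun n => ?_
      nonneg_E := fun n t ht => hsum0 n t ht
      apriori_S := fun T hT => ?_
      apriori_Z := fun T hT => ?_
      apriori_E := fun T hT => ?_
      eq1 := fun n t ht => ?_
      eq2 := fun n t ht => ?_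
      eq3 := fun n t ht => ?_
      eq4 := fun n t ht => ?_
      eqZ1 := fun n t ht => ?_
      eqZ2 := fun n t ht => ?_
      eqZ3 := fun n t ht => ?_
      energy := fun n t ht => ?_
      init_E := fun n => ?_
      init_S := fun i n => ?_
      init_Z := fun i n => ?_
      defect_lower := fun n t ht => ?_
      defect_upper := fun n t ht => ?_
      noLow_E := fun n t hn ht => Finset.sum_eq_zero fun i _ => h.noLow_E i n t hn ht
      noLow_S := fun i n t hn ht => ?_
      noLow_Z := fun i n t hn ht => ?_ }
  -- regularity of S
  · intro i n
    fin_cases i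
    · exact contDiffOn_const.mul ((h.contDiffOn_X 0 n).add (h.contDiffOn_X 1 n))
    · exact h.contDiffOn_X 2 n
    · exact contDiffOn_const.mul ((h.contDiffOn_X 3 n).add (h.contDiffOn_X 4 n))
    · exact contDiffOn_const.mul ((h.contDiffOn_X 5 n).add (h.contDiffOn_X 6 n))
  -- regularity of Z
  · intro i n
    fin_cases i
    · exact contDiffOn_const.mul ((h.contDiffOn_X 0 n).sub (h.contDiffOn_X 1 n))
    · exact contDiffOn_const.mul ((h.contDiffOn_X 3 n).sub (h.contDiffOn_X 4 n))
    · exact contDiffOn_const.mul ((h.contDiffOn_X 5 n).sub (h.contDiffOn_X 6 n))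
  -- regularity of E
  · have hE := fun i => h.contDiffOn_E i n
    simp only [Fin.sum_univ_seven]
    exact ((((((hE 0).add (hE 1)).add (hE 2)).add (hE 3)).add (hE 4)).add (hE 5)).add (hE 6)
  -- a priori bound for S
  · obtain ⟨M, hM⟩ := h.apriori_X T hT
    refine ⟨Real.sqrt 2 * M, fun t ht i n => ?_⟩
    have hwt : 0 ≤ 1 + (1 + ε₀) ^ ((10 : ℝ) * n) := by positivity
    have hM0 : 0 ≤ M := le_trans (by positivity) (hM t ht 0 n)
    have key : ∀ a b : Fin 7, (1 + (1 + ε₀) ^ ((10 : ℝ) * n)) *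
        |Real.sqrt 2 / 2 * (X a n t + X b n t)| ≤ Real.sqrt 2 * M := by
      intro a b
      rw [abs_mul, abs_of_nonneg (by positivity : (0 : ℝ) ≤ Real.sqrt 2 / 2)]
      calc (1 + (1 + ε₀) ^ ((10 : ℝ) * n)) * (Real.sqrt 2 / 2 * |X a n t + X b n t|)
          ≤ (1 + (1 + ε₀) ^ ((10 : ℝ) * n)) * (Real.sqrt 2 / 2 * (|X a n t| + |X b n t|)) := by
            gcongr; exact abs_add_le _ _
        _ = Real.sqrt 2 / 2 * ((1 + (1 + ε₀) ^ ((10 : ℝ) * n)) * |X a n t| +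
              (1 + (1 + ε₀) ^ ((10 : ℝ) * n)) * |X b n t|) := by ring
        _ ≤ Real.sqrt 2 / 2 * (M + M) := by gcongr <;> exact hM t ht _ n
        _ = Real.sqrt 2 * M := by ring
    fin_cases i
    · exact key 0 1
    · calc _ = (1 + (1 + ε₀) ^ ((10 : ℝ) * n)) * |X 2 n t| := rfl
        _ ≤ M := hM t ht 2 n
        _ ≤ Real.sqrt 2 * M := le_mul_of_one_le_left hM0 one_le_sqrt_two
    · exact key 3 4
    · exact key 5 6
  -- a priori bound for Z
  · obtain ⟨M, hM⟩ := h.apriori_X T hT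
    refine ⟨Real.sqrt 2 * M, fun t ht i n => ?_⟩
    have hwt : 0 ≤ 1 + (1 + ε₀) ^ ((10 : ℝ) * n) := by positivity
    have key : ∀ a b : Fin 7, (1 + (1 + ε₀) ^ ((10 : ℝ) * n)) *
        |Real.sqrt 2 / 2 * (X a n t - X b n t)| ≤ Real.sqrt 2 * M := by
      intro a b
      rw [abs_mul, abs_of_nonneg (by positivity : (0 : ℝ) ≤ Real.sqrt 2 / 2)]
      calc (1 + (1 + ε₀) ^ ((10 : ℝ) * n)) * (Real.sqrt 2 / 2 * |X a n t - X b n t|)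
          ≤ (1 + (1 + ε₀) ^ ((10 : ℝ) * n)) * (Real.sqrt 2 / 2 * (|X a n t| + |X b n t|)) := by
            gcongr; exact abs_sub _ _
        _ = Real.sqrt 2 / 2 * ((1 + (1 + ε₀) ^ ((10 : ℝ) * n)) * |X a n t| +
              (1 + (1 + ε₀) ^ ((10 : ℝ) * n)) * |X b n t|) := by ring
        _ ≤ Real.sqrt 2 / 2 * (M + M) := by gcongr <;> exact hM t ht _ n
        _ = Real.sqrt 2 * M := by ring
    fin_cases i
    · exact key 0 1
    · exact key 3 4
    · exact key 5 6
  -- a priori bound for E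
  · obtain ⟨M, hM⟩ := h.apriori_E T hT
    refine ⟨7 * M, fun t ht n => ?_⟩
    have hwt : 0 ≤ 1 + (1 + ε₀) ^ ((10 : ℝ) * n) := by positivity
    calc (1 + (1 + ε₀) ^ ((10 : ℝ) * n)) * Real.sqrt (∑ i, E i n t)
        ≤ (1 + (1 + ε₀) ^ ((10 : ℝ) * n)) * ∑ i, Real.sqrt (E i n t) :=
          mul_le_mul_of_nonneg_left
            (sqrt_finset_sum_le _ _ fun i _ => h.nonneg_E i n t ht.1) hwt
      _ = ∑ i, (1 + (1 + ε₀) ^ ((10 : ℝ) * n)) * Real.sqrt (E i n t) := Finset.mul_sum _ _ _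
      _ ≤ ∑ _i : Fin 7, M := Finset.sum_le_sum fun i _ => hM t ht i n
      _ = 7 * M := by simp
  -- (6.1♯)
  · rw [← quadTerm_splitCoeff_sym_a X n t K ε hε₁,
      show symAmp X 0 n = fun s => Real.sqrt 2 / 2 * (X 0 n s + X 1 n s) from rfl,
      derivWithin_half_sqrt_two_add (h.contDiffOn_X 0 n) (h.contDiffOn_X 1 n) ht]
    simpa using hpair 0 1 n t ht 1 (Or.inl rfl)
  -- (6.2♯)
  · rw [← quadTerm_splitCoeff_sym_b X n t K ε, show symAmp X 1 n = X 2 n from rfl]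
    calc _ ≤ K₁ * (1 + ε₀) ^ ((2 : ℝ) * n) * Real.sqrt (E 2 n t) := hrow 2 n t ht
      _ ≤ K₁ * (1 + ε₀) ^ ((2 : ℝ) * n) * Real.sqrt (∑ k, E k n t) := by
          gcongr; exact hle 2 n t ht
      _ ≤ _ := by
          rw [mul_assoc (Real.sqrt 2), mul_assoc (Real.sqrt 2)]
          exact le_mul_of_one_le_left (by positivity) one_le_sqrt_two
  -- (6.3♯)
  · rw [← quadTerm_splitCoeff_sym_c X n t K ε,
      show symAmp X 2 n = fun s => Real.sqrt 2 / 2 * (X 3 n s + X 4 n s) from rfl,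
      derivWithin_half_sqrt_two_add (h.contDiffOn_X 3 n) (h.contDiffOn_X 4 n) ht]
    simpa using hpair 3 4 n t ht 1 (Or.inl rfl)
  -- (6.4♯)
  · rw [← quadTerm_splitCoeff_sym_d X n t K ε,
      show symAmp X 3 n = fun s => Real.sqrt 2 / 2 * (X 5 n s + X 6 n s) from rfl,
      derivWithin_half_sqrt_two_add (h.contDiffOn_X 5 n) (h.contDiffOn_X 6 n) ht]
    simpa using hpair 5 6 n t ht 1 (Or.inl rfl)
  -- (6.Z1)
  · rw [← quadTerm_splitCoeff_asym_a X n t K ε hε₁,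
      show asymAmp X 0 n = fun s => Real.sqrt 2 / 2 * (X 0 n s - X 1 n s) from rfl,
      derivWithin_half_sqrt_two_sub (h.contDiffOn_X 0 n) (h.contDiffOn_X 1 n) ht]
    simpa [sub_eq_add_neg] using hpair 0 1 n t ht (-1) (Or.inr rfl)
  -- (6.Z2)
  · rw [← quadTerm_splitCoeff_asym_c X n t K ε,
      show asymAmp X 1 n = fun s => Real.sqrt 2 / 2 * (X 3 n s - X 4 n s) from rfl,
      derivWithin_half_sqrt_two_sub (h.contDiffOn_X 3 n) (h.contDiffOn_X 4 n) ht]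
    simpa [sub_eq_add_neg] using hpair 3 4 n t ht (-1) (Or.inr rfl)
  -- (6.Z3)
  · rw [← quadTerm_splitCoeff_asym_d X n t K ε,
      show asymAmp X 2 n = fun s => Real.sqrt 2 / 2 * (X 5 n s - X 6 n s) from rfl,
      derivWithin_half_sqrt_two_sub (h.contDiffOn_X 5 n) (h.contDiffOn_X 6 n) ht]
    simpa [sub_eq_add_neg] using hpair 5 6 n t ht (-1) (Or.inr rfl)
  -- (6.5♯)
  · have hd : ∀ i, HasDerivWithinAt (E i n) (derivWithin (E i n) (Ici 0) t) (Ici 0) t :=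
      fun i => (((h.contDiffOn_E i n).differentiableOn one_ne_zero) t ht).hasDerivWithinAt
    have hsum : HasDerivWithinAt (fun s => ∑ i, E i n s)
        (∑ i, derivWithin (E i n) (Ici 0) t) (Ici 0) t :=
      HasDerivWithinAt.fun_sum fun i _ => hd i
    rw [hsum.derivWithin (uniqueDiffOn_Ici 0 t ht)]
    calc ∑ i, derivWithin (E i n) (Ici 0) t
        ≤ ∑ i, quadTerm ε₀ (splitCoeff ε₀ K ε) X i n t * X i n t :=
          Finset.sum_le_sum fun i _ => h.energy i n t ht
      _ = _ := sum_quadTerm_mul_splitCoeff X n t K ε hε₁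
  -- (6.6♯), energies
  · simp only [Fin.sum_univ_seven, h.init_E, h.init_X]
    by_cases hn : n = n₀
    · simp [hn, splitDatum]
      linear_combination (1 / 4) * sqrt_two_mul_self
    · simp [hn]
  -- (6.6♯), symmetric amplitudes
  · fin_cases i
    · by_cases hn : n = n₀
      · simp [hn, h.init_X, splitDatum]
        linear_combination (1 / 2) * sqrt_two_mul_self
      · simp [hn, h.init_X]
    · by_cases hn : n = n₀ <;> simp [hn, h.init_X, splitDatum]
    · by_cases hn : n = n₀ <;> simp [hn, h.init_X, splitDatum]
    · by_cases hn : n = n₀ <;> simp [hn, h.init_X, splitDatum]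
  -- (6.6♯), asymmetries
  · fin_cases i <;> by_cases hn : n = n₀ <;> simp [hn, h.init_X, splitDatum]
  -- (6.7♯), lower
  · rw [← sum_sq_eq_symAmp_asymAmp, Finset.mul_sum]
    exact Finset.sum_le_sum fun i _ => h.defect_lower i n t ht
  -- (6.7♯), upper
  · have hI : ∀ i, IntervalIntegrable (E i n) volume 0 t := fun i =>
      ((h.contDiffOn_E i n).continuousOn.mono
        (by rw [Set.uIcc_of_le ht]; exact Set.Icc_subset_Ici_self)).intervalIntegrable
    rw [← sum_sq_eq_symAmp_asymAmp]
    calc ∑ i, E i n t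
        ≤ ∑ i, ((1 / 2) * X i n t ^ 2 +
            K₂ * (1 + ε₀) ^ ((2 : ℝ) * n) * ∫ s in (0 : ℝ)..t, E i n s) :=
          Finset.sum_le_sum fun i _ => h.defect_upper i n t ht
      _ = (1 / 2) * ∑ i, X i n t ^ 2 +
            K₂ * (1 + ε₀) ^ ((2 : ℝ) * n) * ∫ s in (0 : ℝ)..t, ∑ i, E i n s := by
          rw [intervalIntegral.integral_finsetSum fun i _ => hI i, Finset.sum_add_distrib,
            Finset.mul_sum, Finset.mul_sum]
  -- (6.8♯), S
  · fin_cases i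
    · simp [h.noLow_X _ n t hn ht]
    · exact h.noLow_X 2 n t hn ht
    · simp [h.noLow_X _ n t hn ht]
    · simp [h.noLow_X _ n t hn ht]
  -- (6.8♯), Z
  · fin_cases i <;> simp [h.noLow_X _ n t hn ht]

end Bridge

/-! ### Theorem 4.2♯ from Theorem 6.2♯ -/

/-- **Theorem 4.2♯ ⇐ Theorem 6.2♯ (PROVED reduction; both statements written out, neither asserted).**
If the split system (6.0♯)–(6.8♯) has no global solution in Tao's parameter regime (the conclusion
shape of `noGlobalSplitODESolution_of_splitBlowupDynamicsStep`), then for every `0 < ε₀ < 1` there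
are `K > 0` and `ε > 0` such that the split table `splitCoeff ε₀ K ε` — symmetric (4.2), cancelling
(4.3) and square-free — admits, for all implied constants `K₁, K₂ ≥ 0` and all sufficiently large
`n₀`, NO family `X_{i,n}, E_{i,n}` obeying the conclusions of Lemma 4.1 with the two-wavelet datum
`splitDatum` on the shell `n₀`. (Tao, p. 31: "To prove Theorem 4.2, it thus suffices to show
Theorem 6.2" — here with `m = 7`, the split table and `CascadeODESolutionFrom.toSplitODESystem`.)
[cite: Tao2016AveragedNS, §6.1] -/
theorem splitOdeBlowup_of_noGlobalSplit
    (h62 : ∀ ε₀ : ℝ, 0 < ε₀ → ε₀ < 1 →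
      ∃ K₀ : ℝ, ∀ K : ℝ, K₀ ≤ K → 0 < K →
        ∃ e₀ : ℝ, 0 < e₀ ∧ ∀ ε : ℝ, 0 < ε → ε ≤ e₀ →
          ∀ C₁ C₂ : ℝ, 0 ≤ C₁ → 0 ≤ C₂ →
            ∃ N₀ : ℤ, ∀ n₀ : ℤ, N₀ ≤ n₀ →
              ¬ ∃ (S : Fin 4 → ℤ → ℝ → ℝ) (Z : Fin 3 → ℤ → ℝ → ℝ) (E : ℤ → ℝ → ℝ),
                SplitODESystem ε₀ K ε C₁ C₂ n₀ S Z E) :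
    ∀ ε₀ : ℝ, 0 < ε₀ → ε₀ < 1 →
      ∃ K ε : ℝ, 0 < K ∧ 0 < ε ∧
        IsSymmetricCoeff (splitCoeff ε₀ K ε) ∧ IsCancellingCoeff (splitCoeff ε₀ K ε) ∧
        IsSquareFreeCoeff (splitCoeff ε₀ K ε) ∧
        ∀ K₁ K₂ : ℝ, 0 ≤ K₁ → 0 ≤ K₂ → ∃ N₀ : ℤ, ∀ n₀ : ℤ, N₀ ≤ n₀ →
          ¬ ∃ X E : Fin 7 → ℤ → ℝ → ℝ,
            CascadeODESolutionFrom ε₀ (splitCoeff ε₀ K ε) K₁ K₂ n₀ splitDatum X E := by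
  intro ε₀ hε₀ hε₀1
  obtain ⟨K₀, hK₀⟩ := h62 ε₀ hε₀ hε₀1
  obtain ⟨e₀, he₀, he⟩ := hK₀ (max K₀ 1) (le_max_left _ _) (lt_max_of_lt_right one_pos)
  refine ⟨max K₀ 1, e₀, lt_max_of_lt_right one_pos, he₀, splitCoeff_symmetric _ _ _,
    splitCoeff_cancelling _ _ _, splitCoeff_squareFree _ _ _, fun K₁ K₂ hK₁ hK₂ => ?_⟩
  obtain ⟨N₀, hN₀⟩ := he e₀ he₀ le_rfl (Real.sqrt 2 * K₁) K₂ (by positivity) hK₂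
  exact ⟨N₀, fun n₀ hn₀ ⟨X, E, hXE⟩ =>
    hN₀ n₀ hn₀ ⟨symAmp X, asymAmp X, fun n t => ∑ i, E i n t, hXE.toSplitODESystem hε₀ hK₁⟩⟩

end Tao2016AveragedNS

end Literature.Analysis.FluidPDE
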